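import Literature.NumberTheory.EllipticCurves.SupersingularMultiplicationByPValuationProofs
import HarnessLib

/-!
# At a supersingular place every `p`-power torsion point lies in the kernel of reduction
# (`|x(P)| > 1`), via division polynomials (Silverman AEC VII.3.1 / V.3.1(a); proofs only)

`Proofs`-style file (THEOREMS ONLY), topic `NumberTheory/EllipticCurves`; sequel of
`SupersingularMultiplicationByPValuationProofs`. Over an arbitrary valued field `(L, |·|)` and a
Weierstrass equation `W` whose `p`-th division polynomials have the SUPERSINGULAR SHAPE
(`|coeff_j Φ_p| ≤ 1` for all `j`, `|coeff₀ ΨSq_p| = 1`, `|coeff_j ΨSq_p| < 1` for `j ≥ 1` — at a place of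
good supersingular reduction `ΨSq_p ≡ c ≢ 0 (mod 𝔪)` is constant, Debry's criterion, tree
`exists_ΨSq_prime_eq_C_of_hasseCoeff_eq_zero`), an affine point `P = (x, y)` has `|x| > 1` (i.e.
reduces to the origin) as soon as it is killed by a power of `p`:

* `one_lt_valuation_X_of_prime_zsmul_eq_zero_of_ΨSq_shape` — `p • P = O ⇒ |x(P)| > 1`
  (`ΨSq_p(x) = 0` is impossible for `|x| ≤ 1`, where `|ΨSq_p(x)| = |coeff₀| = 1`);
* `one_lt_valuation_X_of_zsmul_eq_some_of_ΨSq_shape` — `p • P = (x', y')` with `|x'| > 1 ⇒ |x(P)| > 1`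
  (`x'·ΨSq_p(x) = Φ_p(x)`, Silverman AEC Exercise 3.7(d), and `|Φ_p(x)| ≤ 1 = |ΨSq_p(x)|` for
  `|x| ≤ 1`);
* `one_lt_valuation_X_of_prime_pow_zsmul_eq_zero_of_ΨSq_shape` — hence `pᵏ • P = O` (`k ≥ 1`)
  `⇒ |x(P)| > 1`: **`E[p^∞] ⊆ E₁` at a supersingular place** (Silverman AEC VII.3.1(a) reduction is
  injective on prime-to-`p` torsion; dually, at a supersingular place `Ẽ(k̄)[p] = 0` so ALL `p`-power
  torsion reduces to `Õ` — here without any reduction map).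

What is NOT here: the reduction homomorphism; `p = 2` is allowed by the statements (the shape
hypotheses carry the arithmetic).

## References

* J. H. Silverman, *The Arithmetic of Elliptic Curves*, 2nd ed. (2009), Exercise 3.7(d),(f), V.3.1(a),
  VII.2–VII.3. [SilvermanAEC2009]
* J.-P. Serre, Proc. Conf. Local Fields (Driebergen 1966), Springer 1967, §5 (the `pⁿ`-torsion of a
  connected `p`-divisible group lives in the formal group). [Serre1967GroupesPDivisibles]
-/

noncomputable section

open scoped Classical NNReal

namespace WeierstrassCurve

open Polynomial Literature.NumberTheory.EllipticCurves

variable {L : Type*} [Field L] (w : Valuation L ℝ≥0) (W : WeierstrassCurve L) (p : ℕ)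
  [hp : Fact p.Prime]

/-- `|ΨSq_p(x)| = 1` for `|x| ≤ 1` when `|coeff₀ ΨSq_p| = 1` and `|coeff_j ΨSq_p| < 1` (`j ≥ 1`): the
constant term dominates. [cite: SilvermanAEC2009, Exercise 3.7(f)] -/
theorem valuation_eval_ΨSq_eq_one_of_le_one (hΨ0 : w ((W.ΨSq p).coeff 0) = 1)
    (hΨ : ∀ j, 1 ≤ j → w ((W.ΨSq p).coeff j) < 1) {x : L} (hx : w x ≤ 1) :
    w ((W.ΨSq (p : ℤ)).eval x) = 1 := by
  set N := p ^ 2 with hN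
  have hnat : ((p : ℤ)).natAbs ^ 2 = N := by rw [Int.natAbs_natCast]
  have hN1 : 1 ≤ N := Nat.one_le_pow _ _ hp.out.pos
  have hdeg : (W.ΨSq (p : ℤ)).natDegree < N := by
    have h := W.natDegree_ΨSq_le (p : ℤ)
    rw [hnat] at h
    omega
  rw [eval_eq_sum_range' hdeg]
  obtain ⟨N', hN'⟩ : ∃ N', N = N' + 1 := ⟨N - 1, by omega⟩
  rw [hN', Finset.sum_range_succ']
  simp only [pow_zero, mul_one]
  have hlt : w (∑ i ∈ Finset.range N', (W.ΨSq (p : ℤ)).coeff (i + 1) * x ^ (i + 1)) < 1 := by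
    refine Valuation.map_sum_lt w one_ne_zero fun i _ => ?_
    rw [Valuation.map_mul, Valuation.map_pow]
    calc w ((W.ΨSq (p : ℤ)).coeff (i + 1)) * w x ^ (i + 1)
        ≤ w ((W.ΨSq (p : ℤ)).coeff (i + 1)) * 1 :=
          mul_le_mul_of_nonneg_left (pow_le_one₀ (by positivity) hx) (by positivity)
      _ < 1 := by rw [mul_one]; exact hΨ (i + 1) (by omega)
  rw [Valuation.map_add_eq_of_lt_right w (by rw [hΨ0]; exact hlt), hΨ0]

omit hp in
/-- `|Φ_p(x)| ≤ 1` for `|x| ≤ 1` when `Φ_p` has integral coefficients. [cite: SilvermanAEC2009, Exercise 3.7(b)] -/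
theorem valuation_eval_Φ_le_one_of_le_one (hΦ : ∀ j, w ((W.Φ p).coeff j) ≤ 1) {x : L}
    (hx : w x ≤ 1) : w ((W.Φ (p : ℤ)).eval x) ≤ 1 := by
  rw [eval_eq_sum_range]
  refine Valuation.map_sum_le w fun i _ => ?_
  rw [Valuation.map_mul, Valuation.map_pow]
  calc w ((W.Φ (p : ℤ)).coeff i) * w x ^ i ≤ 1 * 1 :=
        mul_le_mul (hΦ i) (pow_le_one₀ (by positivity) hx) (by positivity) (by positivity)
    _ = 1 := one_mul _

/-- **`p • P = O ⇒ |x(P)| > 1`** under the supersingular shape of `ΨSq_p`: a `p`-torsion point is in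
the kernel of reduction (`ΨSq_p(x(P)) = 0`, tree `zsmul_some_eq_zero_iff_eval_ΨSq`, while
`|ΨSq_p(x)| = 1` for integral `x`). [cite: SilvermanAEC2009, Exercise 3.7(f) and V.3.1(a)] -/
theorem one_lt_valuation_X_of_prime_zsmul_eq_zero_of_ΨSq_shape (hΨ0 : w ((W.ΨSq p).coeff 0) = 1)
    (hΨ : ∀ j, 1 ≤ j → w ((W.ΨSq p).coeff j) < 1) {x y : L} {h : W.toAffine.Nonsingular x y}
    (hP : (p : ℤ) • (Affine.Point.some x y h : W.toAffine.Point) = 0) : 1 < w x := by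
  by_contra hx
  rw [not_lt] at hx
  have h0 : (W.ΨSq (p : ℤ)).eval x = 0 := (W.zsmul_some_eq_zero_iff_eval_ΨSq h (p : ℤ)).mp hP
  have h1 := valuation_eval_ΨSq_eq_one_of_le_one w W p hΨ0 hΨ hx
  rw [h0, map_zero] at h1
  exact zero_ne_one h1

/-- **`p • P = (x', y')` with `|x'| > 1 ⇒ |x(P)| > 1`**: if `p • P` lies in the kernel of reduction so
does `P` (`x'·ΨSq_p(x) = Φ_p(x)`, Silverman AEC Exercise 3.7(d); for integral `x` the right side is
integral and `|ΨSq_p(x)| = 1`). [cite: SilvermanAEC2009, Exercise 3.7(d)] -/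
theorem one_lt_valuation_X_of_zsmul_eq_some_of_ΨSq_shape (hΦ : ∀ j, w ((W.Φ p).coeff j) ≤ 1)
    (hΨ0 : w ((W.ΨSq p).coeff 0) = 1) (hΨ : ∀ j, 1 ≤ j → w ((W.ΨSq p).coeff j) < 1)
    {x y : L} {h : W.toAffine.Nonsingular x y} {x' y' : L} {h' : W.toAffine.Nonsingular x' y'}
    (hP : (p : ℤ) • (Affine.Point.some x y h : W.toAffine.Point) = Affine.Point.some x' y' h')
    (hx' : 1 < w x') : 1 < w x := by
  by_contra hx
  rw [not_lt] at hx
  have key := W.mul_eval_ΨSq_of_zsmul_eq h (p : ℤ) h' hP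
  have h1 := valuation_eval_ΨSq_eq_one_of_le_one w W p hΨ0 hΨ hx
  have h2 := valuation_eval_Φ_le_one_of_le_one w W p hΦ hx
  have h3 : w x' = w ((W.Φ (p : ℤ)).eval x) := by
    rw [← key, Valuation.map_mul, h1, mul_one]
  rw [h3] at hx'
  exact absurd h2 (not_le.mpr hx')

/-- **`E[p^∞] ⊆ E₁` at a supersingular place**: under the supersingular shape of `Φ_p`, `ΨSq_p`,
every affine point killed by `pᵏ` (`k ≥ 1`) has `|x| > 1`. Induction on `k` through the two previous
statements. [cite: SilvermanAEC2009, V.3.1(a) and VII.3.1] -/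
theorem one_lt_valuation_X_of_prime_pow_zsmul_eq_zero_of_ΨSq_shape (hΦ : ∀ j, w ((W.Φ p).coeff j) ≤ 1)
    (hΨ0 : w ((W.ΨSq p).coeff 0) = 1) (hΨ : ∀ j, 1 ≤ j → w ((W.ΨSq p).coeff j) < 1)
    {k : ℕ} (hk : 1 ≤ k) {x y : L} {h : W.toAffine.Nonsingular x y}
    (hP : ((p : ℤ) ^ k) • (Affine.Point.some x y h : W.toAffine.Point) = 0) : 1 < w x := by
  induction k generalizing x y with
  | zero => exact absurd hk (by omega)
  | succ k ih =>
    rcases Nat.eq_zero_or_pos k with rfl | hkpos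
    · rw [zero_add, pow_one] at hP
      exact one_lt_valuation_X_of_prime_zsmul_eq_zero_of_ΨSq_shape w W p hΨ0 hΨ hP
    · -- `Q = p • P` is killed by `p^k`
      have hPQ : ((p : ℤ) ^ k) • ((p : ℤ) • (Affine.Point.some x y h : W.toAffine.Point)) = 0 := by
        rw [← mul_zsmul, ← pow_succ, hP]
      rcases hQ : (p : ℤ) • (Affine.Point.some x y h : W.toAffine.Point) with _ | ⟨x', y', h'⟩
      · exact one_lt_valuation_X_of_prime_zsmul_eq_zero_of_ΨSq_shape w W p hΨ0 hΨ hQ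
      · rw [hQ] at hPQ
        have hx' : 1 < w x' := ih (by omega) hPQ
        exact one_lt_valuation_X_of_zsmul_eq_some_of_ΨSq_shape w W p hΦ hΨ0 hΨ hQ hx'

end WeierstrassCurve

end
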